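import Summits.ABC.IUTFork.Joshi.DictionaryUntiltsVolume
import Summits.ABC.IUTFork.Joshi.UntiltRescaled
import Summits.ABC.IUTFork.Joshi.DictionaryHarnessBridge
import Summits.ABC.IUTFork.Cor312PinnedCountermodel
import Summits.ABC.IUTFork.Cor312CheckBGluedScaledNonVacuity
import HarnessLib

/-!
# The [J-I] cluster vs `S`, COUNTERMODEL side: the EXPONENT-BLIND dictionary on ANY points-signature holds beside the
# pinned `¬S` model — E-plan's Y₁ components are dilatation-compatible; `ExponentFaithful` (p431910) is exactly what the model lacks

Proof-only test file of the abc-iut cell, branch E (seat abc-iut-E-cx-3, THIRD block-E adversary; lane (1) «[J-I] arXiv 2106.11452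
cluster vs S»; rung LADDER-ABC:A2.E; E-PLAN R14: a `Joshi/Test*` file, the only kind allowed to import the frozen `Cor312*` side).
TAKES NO SIDE on [IUTchIII] Cor. 3.12 or on any author (Mochizuki / Scholze–Stix / Joshi / Dupuy–Hilado); typed ≠ proved ≠ endorsed.
No new objects beyond ONE dictionary instance (`blindDictionary`); no `Prop` facts; every statement below is PROVED; frozen files are
imported BY NAME and never restated (DEFS-FREEZE).

THE TEST (E-plan X-rows, R9 grammar; target `S = Cor312Vol.PilotKummerIndRelated`, the `¬S` model of record
`Cor312Vol.PinnedWitness.pinned_countermodel` p419720). The [J-I] carriers of record are abc-iut-E-t1's points-signature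
`UntiltPoints p 𝒪E` (p429850: points `|𝒴_{F,E}|`, moves `Aut_{𝒪_E}(𝒢(𝒪_F))`, action `ptAct` = [J-I] v4 Thm 5.21.1 (3)), the dictionary
instance `UntiltPoints.toDictionary` (p430512; the data `datum`/`real` have NO [J-I] counterpart and are parameters), the scaling exponent
`UntiltPoints.exponent` with `actionDilates_iff_exponent_ne` (p431060 = v4 Thm 5.4.1 existence half, PROVED) and E-t1's LOCATION
`not_movesAreInd_and_datumEquivariant` (p431910: `ActionDilates` + `ExponentFaithful` + volume-invariant (Ind1)/(Ind2) ⇒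
¬(`MovesAreInd` ∧ `DatumEquivariant`)).

WHAT IS PROVED HERE.
* §1 For EVERY points-signature `D`, move `σ` and point `y`, the **exponent-blind dictionary** `blindDictionary D S n y σ :=
  D.toDictionary S y (σ·y) (fun _ ↦ (S.D n).Ψ) (fun _ ↦ 1)` (base `y`, standard point `σ·y` REACHED BY THE MOVE `σ`, every holomorphic
  structure read as the line's Θ-splitting-monoid datum, every move realised by the identity family) satisfies, in EVERY lattice
  situation, all four components of E-plan's Y₁ — `BaseIsThetaPilot`, `MovesAreInd`, `DatumEquivariant`, `StdReachable` — hence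
  `AnsatzWithinInd` (E-plan's `ansatzWithinInd_of_moves`, BY NAME).
* §2 The blind datum is NEVER `ExponentFaithful` once two holomorphic structures have different exponents — in particular never when
  Joshi's action DILATES (`ActionDilates`, [J-I] v4 Cor 5.4.2): `not_exponentFaithful_blind_of_actionDilates`. So p431910's location is
  TIGHT on its one non-structural hypothesis: drop `ExponentFaithful` and `MovesAreInd ∧ DatumEquivariant` coexist with `ActionDilates`.
* §3 At abc-iut-w4-d101's pinned countermodel (`pinnedSetting q` over `naiveFull q`, operator `orbitRegion q`, q-datum `qDatum q`;
  typed Thm 3.11 (i)–(iii) ∧ `BridgeHyps` ∧ `AbsLogQPos` ∧ `PinnedRegions3` hold, `S` and the typed Statement FAIL — all BY NAME) the blind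
  dictionary on ANY `D` has `AnsatzWithinInd` TRUE and `StandardPointIsQPilot` FALSE (abc-iut-E-cx's X-02 `DictionaryHarnessBridge`, BY NAME).
* §4 `blind_countermodel` packages it (FQ types): for every `D σ y` a joint model «typed Thm 3.11 ∧ BridgeHyps ∧ AbsLogQPos ∧ PinnedRegions3 ∧
  Y₁(all four components) ∧ AnsatzWithinInd ∧ ¬StandardPointIsQPilot ∧ ¬S ∧ ¬Statement» on the [J-I] carriers `(D.Pt, D.Aut, ptAct)` with
  `std = σ·base`; `blind_countermodel_of_exponent_ne` adds `ActionDilates ∧ ¬ExponentFaithful` when `exponent (σ·y) ≠ exponent y`.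

* §5 NON-VACUOUSLY, on abc-iut-E-t1's CONTENTFUL three-point signature `threePoint p 2` (UntiltRescaled p432361: `ℂ_p` and two
  rescaled copies `ℂ_p^{(2)}` permuted by `Aut(𝔽₂²)`; `threePoint_actionDilates`, BY NAME): `threePoint_blind_countermodel` — Joshi's action
  DILATES (`IsDilatation e₁ (swap·e₁) 2`) AND the joint model of §4 exists on the same carriers.

* §6 THE OTHER HORN at the pinned model (p431910 INSTANTIATED there, BY NAME: (hρ) = `pinnedSetting_thetaPinned`, admissibility /
  log-volume invariance of the sign-acting (Ind1)/(Ind2) = `naiveData_adm_iff_image` / `naiveData_logvolInvariant`): on a DILATING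
  signature no ball-valued reading has `MovesAreInd ∧ DatumEquivariant ∧ ExponentFaithful` — J-FALSE-AT-PINNED datum (R13); with §3 a
  DICHOTOMY: at the `¬S` model a [J-I] dictionary is exponent-blind (Y₁ may hold, Y₂ fails) or exponent-faithful (Y₁'s components fail).

READING (neutral, R9/R13/R15 of plan/E): «COUNTERMODEL for the [J-I] cluster's DICTIONARY AXIOMS: the typed [J-I] move data together
with every component of Y₁ = `AnsatzWithinInd` hold at the ¬S model, for every points-signature — including any on which Joshi's action
dilates; the S-content of the cluster therefore sits ENTIRELY in (a) Y₂ = `StandardPointIsQPilot` (graded STRONGER-THAN-PRINT by E-ref,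
06:27:16Z — a LOCATION, not evidence toward S) and (b) the datum↔exponent link `ExponentFaithful` of p431910, which the blind datum
violates.» Whether a NON-blind, exponent-faithful datum with Y₁ exists at a volume-NON-invariant instantiation is E-PLAN Q2 / X-06 / X-07′,
untouched here. Non-vacuity of `ActionDilates` (a points-signature with two exponents in one orbit) is abc-iut-E-t1's `UntiltRescaled` (p432361),
consumed BY NAME in §5. [claim: Joshi2021ATS1, status: disputed]
-/

noncomputable section

open Set

namespace Summit.ABC.IUTFork.Joshi

namespace UntiltPoints

open Summit.ABC.IUTFork.Thm311 Summit.ABC.IUTFork.Cor312 Summit.ABC.IUTFork.Cor312Vol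

variable {p : ℕ} [Fact p.Prime] {𝒪E : Type} [CommRing 𝒪E] {T : ThetaIndex}

/-! ## 1. The exponent-blind dictionary on a points-signature: Y₁ holds in every situation -/

/-- **The exponent-blind dictionary** on the [J-I] carriers `(D.Pt, D.Aut, ptAct)`: base point `y`, standard point `σ·y` (reached by
the move `σ`), EVERY holomorphic structure read as the line's Θ-splitting-monoid datum `(S.D n).Ψ`, every move realised by the identity
family of packet automorphisms. An instance of E-t1's `toDictionary` (p430512) — the two free parameters filled blindly. [folklore] -/
def blindDictionary (D : UntiltPoints p 𝒪E) (S : LatticeSituation T) (n : ℤ) (y : D.Pt) (σ : D.Aut) : Dictionary S :=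
  D.toDictionary S y (D.ptAct σ y) (fun _ => (S.D n).Ψ) fun _ => 1

variable (D : UntiltPoints p 𝒪E) (S : LatticeSituation T) (P : Cor312.Setting S.toSituation)
  (ρ : (∀ v : T.V, v ∈ T.Vbad → Set (S.L.StarPacket v)) → ∀ (j : T.Label) (vQ : T.VQ), Set (S.L.Packet j vQ))
  (y : D.Pt) (σ : D.Aut)

/-- `BaseIsThetaPilot` holds for the blind dictionary (by construction). [folklore] -/
theorem baseIsThetaPilot_blind : BaseIsThetaPilot (D.blindDictionary S P.n y σ) (P := P) := rfl

/-- `MovesAreInd` holds for the blind dictionary (the identity family lies in `⟨(Ind1) ∪ (Ind2)⟩`). [folklore] -/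
theorem movesAreInd_blind (n : ℤ) : MovesAreInd (D.blindDictionary S n y σ) := fun _ => one_mem _

/-- `DatumEquivariant` holds for the blind dictionary (the identity family transports the constant datum to itself). [folklore] -/
theorem datumEquivariant_blind (n : ℤ) : DatumEquivariant (D.blindDictionary S n y σ) := by
  intro g z v hv
  show (S.D n).Ψ v hv = S.L.starAut 1 v '' (S.D n).Ψ v hv
  have : S.L.starAut (1 : S.L.PacketAut) v = LinearEquiv.refl ℚ _ := by
    ext x j
    rfl
  rw [this]
  exact (Set.image_id _).symm

/-- `StdReachable` holds for the blind dictionary: the standard point `σ·y` is reached from `y` by the ONE move `σ`. [folklore] -/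
theorem stdReachable_blind (n : ℤ) : StdReachable (D.blindDictionary S n y σ) := ⟨[σ], rfl⟩

/-- The standard point of the blind dictionary lies in the `Aut_{𝒪_E}(𝒢(𝒪_F))`-orbit of its base (E-t1's orbit form). [folklore] -/
theorem std_mem_ptOrbit_blind : D.ptAct σ y ∈ D.ptOrbit y := ⟨σ, rfl⟩

/-- Hence **Y₁ = `AnsatzWithinInd` HOLDS for the blind dictionary on EVERY points-signature, in EVERY situation, for EVERY `ρ`**
(E-plan's `ansatzWithinInd_of_moves`, BY NAME). [folklore] -/
theorem ansatzWithinInd_blind : AnsatzWithinInd ρ (D.blindDictionary S P.n y σ) (P := P) :=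
  ansatzWithinInd_of_moves ρ _ (baseIsThetaPilot_blind D S P y σ) (movesAreInd_blind D S y σ P.n)
    (datumEquivariant_blind D S y σ P.n) (stdReachable_blind D S y σ P.n)

/-- For the blind dictionary, Y₂ = `StandardPointIsQPilot` READS: up to `ρ`, the q-pilot Kummer datum IS the line's Θ-monoid datum
(unfolding) — the sentence abc-iut-w5-d230/w4-d101 isolated as what no clause of the typed Thm 3.11 states. [folklore] -/
theorem standardPointIsQPilot_blind_iff (qK : ∀ v : T.V, v ∈ T.Vbad → Set (S.L.StarPacket v)) (n : ℤ) :
    StandardPointIsQPilot ρ qK (D.blindDictionary S n y σ) ↔ ∀ (j : T.Label) (vQ : T.VQ), ρ (S.D n).Ψ j vQ = ρ qK j vQ :=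
  Iff.rfl

/-! ## 2. The blind datum violates `ExponentFaithful` as soon as two exponents differ (tightness of p431910) -/

/-- A CONSTANT datum is never exponent-faithful once two holomorphic structures have different scaling exponents. [folklore] -/
theorem not_exponentFaithful_const_of_exponent_ne (n : ℤ) (Ψ : ∀ v : T.V, v ∈ T.Vbad → Set (S.L.StarPacket v))
    {y₁ y₂ : D.Pt} (hne : D.exponent y₁ ≠ D.exponent y₂) : ¬ ExponentFaithful D S n ρ fun _ => Ψ := by
  rintro ⟨j, vQ, κ, hκ, hfaith⟩
  exact hne (mul_left_cancel₀ hκ ((hfaith y₁).symm.trans (hfaith y₂)))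

/-- In particular the blind dictionary's datum is never exponent-faithful when `exponent (σ·y) ≠ exponent y`. [folklore] -/
theorem not_exponentFaithful_blind_of_exponent_ne (n : ℤ) (hne : D.exponent (D.ptAct σ y) ≠ D.exponent y) :
    ¬ ExponentFaithful D S n ρ (D.blindDictionary S n y σ).datum :=
  not_exponentFaithful_const_of_exponent_ne D S ρ n _ hne

/-- … and never when Joshi's action DILATES (`ActionDilates`, [J-I] v4 Cor 5.4.2; via E-t1's `actionDilates_iff_exponent_ne`).
«¬ExponentFaithful(blind datum) follows from ActionDilates as typed.» [claim: Joshi2021ATS1, status: disputed] -/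
theorem not_exponentFaithful_blind_of_actionDilates (n : ℤ) (hDil : D.ActionDilates) :
    ¬ ExponentFaithful D S n ρ fun _ => (S.D n).Ψ := by
  obtain ⟨τ, z, hne⟩ := D.actionDilates_iff_exponent_ne.1 hDil
  exact not_exponentFaithful_const_of_exponent_ne D S ρ n _ hne

/-- Tightness of p431910, spelled out: with the blind data, `MovesAreInd ∧ DatumEquivariant` HOLD although the action dilates — so in
E-t1's `not_movesAreInd_and_datumEquivariant` the hypothesis `ExponentFaithful` cannot be dropped. [folklore] -/
theorem movesAreInd_and_datumEquivariant_blind (n : ℤ) :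
    MovesAreInd (D.blindDictionary S n y σ) ∧ DatumEquivariant (D.blindDictionary S n y σ) :=
  ⟨movesAreInd_blind D S y σ n, datumEquivariant_blind D S y σ n⟩

end UntiltPoints

/-! ## 3. At the pinned `¬S` model: Y₁ TRUE, Y₂ FALSE for the blind dictionary on every points-signature -/

section Pinned

open Summit.ABC.IUTFork.Thm311 Summit.ABC.IUTFork.Cor312 Summit.ABC.IUTFork.Cor312Vol
open Cor312.Checks PinnedWitness NaiveWitness

variable {p : ℕ} [Fact p.Prime] {𝒪E : Type} [CommRing 𝒪E] (D : UntiltPoints p 𝒪E) (y : D.Pt) (σ : D.Aut)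
  (q : ℕ) [Fact q.Prime]

omit [Fact q.Prime] in
/-- At the pinned countermodel, **Y₁ HOLDS** for the blind dictionary on any points-signature (§1 at `pinnedSetting q`). [folklore] -/
theorem ansatzWithinInd_blind_pinned :
    AnsatzWithinInd (orbitRegion q) (D.blindDictionary (naiveFull q).toLatticeSituation (pinnedSetting q).n y σ)
      (P := pinnedSetting q) :=
  UntiltPoints.ansatzWithinInd_blind D (naiveFull q).toLatticeSituation (pinnedSetting q) (orbitRegion q) y σ

/-- At the pinned countermodel, **Y₂ = `StandardPointIsQPilot` FAILS** for the blind dictionary on any points-signature (abc-iut-E-cx's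
X-02 `pinnedSetting_not_ansatzWithinInd_of_stdIsQPilot`, BY NAME: Y₁ ∧ Y₂ would give `S`, refuted there). [folklore] -/
theorem not_standardPointIsQPilot_blind_pinned :
    ¬ StandardPointIsQPilot (orbitRegion q) (PinnedWitness.qDatum q)
        (D.blindDictionary (naiveFull q).toLatticeSituation (pinnedSetting q).n y σ) := fun h2 =>
  pinnedSetting_not_ansatzWithinInd_of_stdIsQPilot q _ h2 (ansatzWithinInd_blind_pinned D y σ q)

end Pinned

/-! ## 4. The packaged joint model (FQ types) -/

section Packaged

open Summit.ABC.IUTFork.Thm311 Summit.ABC.IUTFork.Cor312 Summit.ABC.IUTFork.Cor312Vol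
open Cor312.Checks PinnedWitness NaiveWitness

variable {p : ℕ} [Fact p.Prime] {𝒪E : Type} [CommRing 𝒪E]

/-- **COUNTERMODEL side of the [J-I] cluster (dictionary axioms).** For EVERY points-signature `D : UntiltPoints p 𝒪E`, move `σ` and
point `y` there are a typed Thm-3.11 situation with its Statement, a Cor.-3.12 setting with the bridge hypotheses, `|log(q)| > 0` and the
THREE PINS, and data `datum`/`real` for E-t1's dictionary on the [J-I] carriers with base `y` and standard point `σ·y`, such that ALL FOUR
components of Y₁ and `AnsatzWithinInd` HOLD while `StandardPointIsQPilot`, `S = PilotKummerIndRelated` and the typed Statement FAIL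
(the pinned countermodel p419720 with the exponent-blind data). [folklore] -/
theorem blind_countermodel (D : Summit.ABC.IUTFork.Joshi.UntiltPoints p 𝒪E) (σ : D.Aut) (y : D.Pt) :
    ∃ (T : Summit.ABC.IUTFork.Thm311.ThetaIndex) (F : Summit.ABC.IUTFork.Thm311.FullSituation T)
      (P : Summit.ABC.IUTFork.Cor312.Setting F.toLatticeSituation.toSituation)
      (ρ : (∀ v : T.V, v ∈ T.Vbad → Set (F.L.StarPacket v)) → ∀ (j : T.Label) (vQ : T.VQ), Set (F.L.Packet j vQ))
      (qK : ∀ v : T.V, v ∈ T.Vbad → Set (F.L.StarPacket v))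
      (datum : D.Pt → ∀ v : T.V, v ∈ T.Vbad → Set (F.L.StarPacket v)) (real : D.Aut → F.L.PacketAut),
      F.Statement ∧ Summit.ABC.IUTFork.Cor312Vol.BridgeHyps P ∧ P.AbsLogQPos ∧
      Summit.ABC.IUTFork.Cor312Vol.PinnedRegions3 F.toLatticeSituation P ρ qK ∧
      Summit.ABC.IUTFork.Joshi.BaseIsThetaPilot (D.toDictionary F.toLatticeSituation y (D.ptAct σ y) datum real) (P := P) ∧
      Summit.ABC.IUTFork.Joshi.MovesAreInd (D.toDictionary F.toLatticeSituation y (D.ptAct σ y) datum real) ∧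
      Summit.ABC.IUTFork.Joshi.DatumEquivariant (D.toDictionary F.toLatticeSituation y (D.ptAct σ y) datum real) ∧
      Summit.ABC.IUTFork.Joshi.StdReachable (D.toDictionary F.toLatticeSituation y (D.ptAct σ y) datum real) ∧
      Summit.ABC.IUTFork.Joshi.AnsatzWithinInd ρ (D.toDictionary F.toLatticeSituation y (D.ptAct σ y) datum real) (P := P) ∧
      ¬ Summit.ABC.IUTFork.Joshi.StandardPointIsQPilot ρ qK (D.toDictionary F.toLatticeSituation y (D.ptAct σ y) datum real) ∧
      ¬ Summit.ABC.IUTFork.Cor312Vol.PilotKummerIndRelated F.toLatticeSituation P ρ qK ∧ ¬ P.Statement := by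
  haveI : Fact (Nat.Prime 2) := ⟨Nat.prime_two⟩
  exact ⟨toyIndex, naiveFull 2, pinnedSetting 2, orbitRegion 2, PinnedWitness.qDatum 2, fun _ => ((naiveFull 2).D (pinnedSetting 2).n).Ψ,
    fun _ => 1, naiveFull_statement 2, pinnedSetting_bridgeHyps 2, pinnedSetting_absLogQPos 2, pinnedSetting_pinnedRegions3 2,
    UntiltPoints.baseIsThetaPilot_blind D (naiveFull 2).toLatticeSituation (pinnedSetting 2) y σ, UntiltPoints.movesAreInd_blind D (naiveFull 2).toLatticeSituation y σ _,
    UntiltPoints.datumEquivariant_blind D (naiveFull 2).toLatticeSituation y σ _, UntiltPoints.stdReachable_blind D (naiveFull 2).toLatticeSituation y σ _,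
    ansatzWithinInd_blind_pinned D y σ 2, not_standardPointIsQPilot_blind_pinned D y σ 2,
    pinnedSetting_not_pilotKummerIndRelated 2, pinnedSetting_not_statement 2⟩

/-- **The same WITH Joshi's dilatation**, consuming a dilating pair BY HYPOTHESIS (non-vacuity = a points-signature with two exponents in
one orbit, abc-iut-E-t1's `UntiltRescaled`): if `exponent (σ·y) ≠ exponent y` then, in addition, `ActionDilates` HOLDS for `D` and the
model's datum is NOT `ExponentFaithful` — the joint model «[J-I] move data ∧ ActionDilates ∧ Y₁ ∧ ¬ExponentFaithful ∧ ¬Y₂ ∧ ¬S ∧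
¬Statement». «consistency of (ActionDilates, MovesAreInd, DatumEquivariant, BaseIsThetaPilot, StdReachable, ¬S) follows from a dilating
pair as typed.» [claim: Joshi2021ATS1, status: disputed] -/
theorem blind_countermodel_of_exponent_ne (D : Summit.ABC.IUTFork.Joshi.UntiltPoints p 𝒪E) (σ : D.Aut) (y : D.Pt)
    (hne : D.exponent (D.ptAct σ y) ≠ D.exponent y) :
    D.ActionDilates ∧
    ∃ (T : Summit.ABC.IUTFork.Thm311.ThetaIndex) (F : Summit.ABC.IUTFork.Thm311.FullSituation T)
      (P : Summit.ABC.IUTFork.Cor312.Setting F.toLatticeSituation.toSituation)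
      (ρ : (∀ v : T.V, v ∈ T.Vbad → Set (F.L.StarPacket v)) → ∀ (j : T.Label) (vQ : T.VQ), Set (F.L.Packet j vQ))
      (qK : ∀ v : T.V, v ∈ T.Vbad → Set (F.L.StarPacket v))
      (datum : D.Pt → ∀ v : T.V, v ∈ T.Vbad → Set (F.L.StarPacket v)) (real : D.Aut → F.L.PacketAut),
      F.Statement ∧ Summit.ABC.IUTFork.Cor312Vol.BridgeHyps P ∧ P.AbsLogQPos ∧
      Summit.ABC.IUTFork.Cor312Vol.PinnedRegions3 F.toLatticeSituation P ρ qK ∧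
      Summit.ABC.IUTFork.Joshi.MovesAreInd (D.toDictionary F.toLatticeSituation y (D.ptAct σ y) datum real) ∧
      Summit.ABC.IUTFork.Joshi.DatumEquivariant (D.toDictionary F.toLatticeSituation y (D.ptAct σ y) datum real) ∧
      Summit.ABC.IUTFork.Joshi.AnsatzWithinInd ρ (D.toDictionary F.toLatticeSituation y (D.ptAct σ y) datum real) (P := P) ∧
      ¬ Summit.ABC.IUTFork.Joshi.UntiltPoints.ExponentFaithful D F.toLatticeSituation P.n ρ datum ∧
      ¬ Summit.ABC.IUTFork.Joshi.StandardPointIsQPilot ρ qK (D.toDictionary F.toLatticeSituation y (D.ptAct σ y) datum real) ∧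
      ¬ Summit.ABC.IUTFork.Cor312Vol.PilotKummerIndRelated F.toLatticeSituation P ρ qK ∧ ¬ P.Statement := by
  haveI : Fact (Nat.Prime 2) := ⟨Nat.prime_two⟩
  refine ⟨D.actionDilates_iff_exponent_ne.2 ⟨σ, y, hne⟩, toyIndex, naiveFull 2, pinnedSetting 2, orbitRegion 2, PinnedWitness.qDatum 2,
    fun _ => ((naiveFull 2).D (pinnedSetting 2).n).Ψ, fun _ => 1, naiveFull_statement 2, pinnedSetting_bridgeHyps 2,
    pinnedSetting_absLogQPos 2, pinnedSetting_pinnedRegions3 2, UntiltPoints.movesAreInd_blind D (naiveFull 2).toLatticeSituation y σ _,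
    UntiltPoints.datumEquivariant_blind D (naiveFull 2).toLatticeSituation y σ _, ansatzWithinInd_blind_pinned D y σ 2,
    UntiltPoints.not_exponentFaithful_blind_of_exponent_ne D (naiveFull 2).toLatticeSituation (orbitRegion 2) y σ _ hne,
    not_standardPointIsQPilot_blind_pinned D y σ 2, pinnedSetting_not_pilotKummerIndRelated 2, pinnedSetting_not_statement 2⟩

end Packaged

/-! ## 5. NON-VACUOUSLY: on abc-iut-E-t1's three-point signature (p432361) the action dilates AND the joint model of §4 exists -/

section ThreePoint

open Summit.ABC.IUTFork.Thm311 Summit.ABC.IUTFork.Cor312 Summit.ABC.IUTFork.Cor312Vol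
open Cor312.Checks PinnedWitness NaiveWitness

variable (p : ℕ) [Fact p.Prime]

/-- On E-t1's three-point signature with profile `(1, 2, 2)` the swap DOUBLES the exponent: `exponent (swap·e₁) = 2 ≠ 1 = exponent e₁`
(`exponent_threePoint`, `ptAct_swap_e1`, BY NAME). [folklore] -/
theorem exponent_swap_e1_ne :
    (threePoint p 2 two_pos).exponent ((threePoint p 2 two_pos).ptAct (swapAut p 2 two_pos) e1) ≠
      (threePoint p 2 two_pos).exponent e1 := by
  rw [ptAct_swap_e1, exponent_threePoint, exponent_threePoint]
  unfold expo
  rw [if_neg e1_ne_e2.symm, if_pos rfl]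
  norm_num

/-- **THE [J-I]-CLUSTER COUNTERMODEL, NON-VACUOUS (dictionary axioms + dilatation vs `S`).** There is a CONTENTFUL points-signature
(E-t1's `threePoint p 2`: three holomorphic structures `ℂ_p`, `ℂ_p^{(2)}`, `ℂ_p^{(2)}` permuted by `Aut(𝔽₂²)`), a move `σ` (the swap) and a
point `y = e₁` such that Joshi's action DILATES (`ActionDilates`; indeed `IsDilatation y (σ·y) 2`), and — on the SAME carriers — a typed
Thm-3.11 situation with its Statement, a Cor.-3.12 setting with BridgeHyps, `|log(q)| > 0` and the THREE PINS, and dictionary data with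
base `y`, standard point `σ·y`, for which `MovesAreInd ∧ DatumEquivariant ∧ AnsatzWithinInd` HOLD while `ExponentFaithful`,
`StandardPointIsQPilot`, `S = PilotKummerIndRelated` and the typed Statement FAIL. «(ActionDilates ∧ Y₁ ∧ ¬S ∧ ¬Statement) is
consistent as typed; the residual of the [J-I] cluster toward S is ExponentFaithful (p431910) + StandardPointIsQPilot (Y₂).»
[claim: Joshi2021ATS1, status: disputed] -/
theorem threePoint_blind_countermodel :
    ∃ (D : Summit.ABC.IUTFork.Joshi.UntiltPoints p (ZMod 2)) (σ : D.Aut) (y : D.Pt),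
      D.ActionDilates ∧ D.IsDilatation y (D.ptAct σ y) 2 ∧
      ∃ (T : Summit.ABC.IUTFork.Thm311.ThetaIndex) (F : Summit.ABC.IUTFork.Thm311.FullSituation T)
        (P : Summit.ABC.IUTFork.Cor312.Setting F.toLatticeSituation.toSituation)
        (ρ : (∀ v : T.V, v ∈ T.Vbad → Set (F.L.StarPacket v)) → ∀ (j : T.Label) (vQ : T.VQ), Set (F.L.Packet j vQ))
        (qK : ∀ v : T.V, v ∈ T.Vbad → Set (F.L.StarPacket v))
        (datum : D.Pt → ∀ v : T.V, v ∈ T.Vbad → Set (F.L.StarPacket v)) (real : D.Aut → F.L.PacketAut),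
        F.Statement ∧ Summit.ABC.IUTFork.Cor312Vol.BridgeHyps P ∧ P.AbsLogQPos ∧
        Summit.ABC.IUTFork.Cor312Vol.PinnedRegions3 F.toLatticeSituation P ρ qK ∧
        Summit.ABC.IUTFork.Joshi.MovesAreInd (D.toDictionary F.toLatticeSituation y (D.ptAct σ y) datum real) ∧
        Summit.ABC.IUTFork.Joshi.DatumEquivariant (D.toDictionary F.toLatticeSituation y (D.ptAct σ y) datum real) ∧
        Summit.ABC.IUTFork.Joshi.AnsatzWithinInd ρ (D.toDictionary F.toLatticeSituation y (D.ptAct σ y) datum real) (P := P) ∧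
        ¬ Summit.ABC.IUTFork.Joshi.UntiltPoints.ExponentFaithful D F.toLatticeSituation P.n ρ datum ∧
        ¬ Summit.ABC.IUTFork.Joshi.StandardPointIsQPilot ρ qK (D.toDictionary F.toLatticeSituation y (D.ptAct σ y) datum real) ∧
        ¬ Summit.ABC.IUTFork.Cor312Vol.PilotKummerIndRelated F.toLatticeSituation P ρ qK ∧ ¬ P.Statement := by
  obtain ⟨hDil, hrest⟩ :=
    blind_countermodel_of_exponent_ne (threePoint p 2 two_pos) (swapAut p 2 two_pos) e1 (exponent_swap_e1_ne p)
  exact ⟨threePoint p 2 two_pos, swapAut p 2 two_pos, e1, hDil,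
    (ptAct_swap_e1 p 2 two_pos).symm ▸ threePoint_isDilatation p 2 two_pos, hrest⟩

end ThreePoint

/-! ## 6. The other horn at the pinned model: an EXPONENT-FAITHFUL equivariant reading of a dilating action is impossible there
(E-t1's location p431910 INSTANTIATED at the `¬S` model of record, whose (Ind1)/(Ind2) act by signs and fix every ball) -/

section Faithful

open Summit.ABC.IUTFork.Thm311 Summit.ABC.IUTFork.Cor312 Summit.ABC.IUTFork.Cor312Vol
open Cor312.Checks PinnedWitness NaiveWitness

variable {p : ℕ} [Fact p.Prime] {𝒪E : Type} [CommRing 𝒪E] (D : UntiltPoints p 𝒪E) (q : ℕ) [Fact q.Prime]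
  {base std : D.Pt} (datum : D.Pt → ∀ v : toyIndex.V, v ∈ toyIndex.Vbad → Set ((naiveFull q).L.StarPacket v))
  (real : D.Aut → (naiveFull q).L.PacketAut)

/-- **J-FALSE-AT-PINNED for «Y₁-components ∧ ExponentFaithful» on a dilating signature.** At the pinned countermodel the
(Ind1)/(Ind2) generators act by signs, preserve admissibility (`naiveData_adm_iff_image`) and log-volume (`naiveData_logvolInvariant`),
and `orbitRegion` is `⟨(Ind1) ∪ (Ind2)⟩`-equivariant (`pinnedSetting_thetaPinned`, (hρ)) — all BY NAME; so E-t1's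
`not_movesAreInd_and_datumEquivariant` applies: for EVERY points-signature on which Joshi's action DILATES and EVERY dictionary data
`(datum, real)` whose `orbitRegion`-regions are admissible (balls), `MovesAreInd ∧ DatumEquivariant` EXCLUDES `ExponentFaithful`.
With §3: at the `¬S` model a [J-I] dictionary is either exponent-blind (Y₁ may hold, Y₂ fails) or exponent-faithful (then
`MovesAreInd ∧ DatumEquivariant` fails). R13 datum, logic + names only. [claim: Joshi2021ATS1, status: disputed] -/
theorem pinned_not_movesAreInd_and_datumEquivariant_of_exponentFaithful (hDil : D.ActionDilates)
    (hadm : ∀ (y : D.Pt) (j : toyIndex.Label) (vQ : toyIndex.VQ),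
      ((naiveFull q).toLatticeSituation.D (pinnedSetting q).n).Adm j vQ (orbitRegion q (datum y) j vQ))
    (hX : UntiltPoints.ExponentFaithful D (naiveFull q).toLatticeSituation (pinnedSetting q).n (orbitRegion q) datum) :
    ¬ (MovesAreInd (D.toDictionary (naiveFull q).toLatticeSituation base std datum real) ∧
        DatumEquivariant (D.toDictionary (naiveFull q).toLatticeSituation base std datum real)) :=
  UntiltPoints.not_movesAreInd_and_datumEquivariant (S := (naiveFull q).toLatticeSituation) (pinnedSetting q).n (orbitRegion q)
    (pinnedSetting_thetaPinned q).1 (naiveData_adm_iff_image q) (naiveData_logvolInvariant q) hadm hX hDil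

/-- The same as a DICHOTOMY at the pinned model, for dilating signatures and ball-valued readings: Y₁'s two load-bearing components
force the reading to be exponent-UNfaithful. [claim: Joshi2021ATS1, status: disputed] -/
theorem pinned_not_exponentFaithful_of_movesAreInd (hDil : D.ActionDilates)
    (hadm : ∀ (y : D.Pt) (j : toyIndex.Label) (vQ : toyIndex.VQ),
      ((naiveFull q).toLatticeSituation.D (pinnedSetting q).n).Adm j vQ (orbitRegion q (datum y) j vQ))
    (hM : MovesAreInd (D.toDictionary (naiveFull q).toLatticeSituation base std datum real))
    (hE : DatumEquivariant (D.toDictionary (naiveFull q).toLatticeSituation base std datum real)) :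
    ¬ UntiltPoints.ExponentFaithful D (naiveFull q).toLatticeSituation (pinnedSetting q).n (orbitRegion q) datum := fun hX =>
  pinned_not_movesAreInd_and_datumEquivariant_of_exponentFaithful D q datum real hDil hadm hX ⟨hM, hE⟩

/-- NON-VACUOUSLY (E-t1's `threePoint p 2`, `threePoint_actionDilates` BY NAME): on the three-point signature, at the pinned model, no
ball-valued equivariant reading inside `⟨(Ind1) ∪ (Ind2)⟩` is exponent-faithful. [claim: Joshi2021ATS1, status: disputed] -/
theorem threePoint_pinned_not_exponentFaithful {base std : (threePoint p 2 two_pos).Pt}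
    (datum : (threePoint p 2 two_pos).Pt → ∀ v : toyIndex.V, v ∈ toyIndex.Vbad → Set ((naiveFull q).L.StarPacket v))
    (real : (threePoint p 2 two_pos).Aut → (naiveFull q).L.PacketAut)
    (hadm : ∀ (y : (threePoint p 2 two_pos).Pt) (j : toyIndex.Label) (vQ : toyIndex.VQ),
      ((naiveFull q).toLatticeSituation.D (pinnedSetting q).n).Adm j vQ (orbitRegion q (datum y) j vQ))
    (hM : Summit.ABC.IUTFork.Joshi.MovesAreInd
      ((threePoint p 2 two_pos).toDictionary (naiveFull q).toLatticeSituation base std datum real))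
    (hE : Summit.ABC.IUTFork.Joshi.DatumEquivariant
      ((threePoint p 2 two_pos).toDictionary (naiveFull q).toLatticeSituation base std datum real)) :
    ¬ Summit.ABC.IUTFork.Joshi.UntiltPoints.ExponentFaithful (threePoint p 2 two_pos) (naiveFull q).toLatticeSituation
        (pinnedSetting q).n (orbitRegion q) datum :=
  pinned_not_exponentFaithful_of_movesAreInd _ q datum real (threePoint_actionDilates p 2 two_pos (by norm_num)) hadm hM hE

end Faithful

end Summit.ABC.IUTFork.Joshi

end
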